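import Literature.MathematicalPhysics.QuantumFieldTheory.StochasticAcceptanceSpectrum
import Literature.MathematicalPhysics.QuantumFieldTheory.GaussianToolkit
import Literature.Analysis.SpecialFunctions.ComplexGaussianDeterminant
import HarnessLib

/-!
# Knechtli–Wolff (4.11)–(4.14): from the Gaussian pseudofermion integral to the spectral formula

Topic `MathematicalPhysics/QuantumFieldTheory`; sequel of `StochasticAcceptanceSpectrum.lean` (which
proves (4.13) = (4.14) for i.i.d. `Exp(1)` variables) and of `PseudofermionIntegral.lean` (which holds
(4.1)–(4.9) for the Gaussian integral `∫D[η] min[ρ(η), ρ(Mη)]` itself).  PUBLISHED RESULTS, proved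
here (no named fact, D-0026); wanted by the cell pub-lqcd (HOME/R2-SCOPE.md §2 row G1).

The statements as printed.  Knechtli–Wolff, Nucl. Phys. B 663 (2003) 3, §4.1, with
`D[η] = ∏ₓ d Re η(x) d Im η(x)/π` and `ρ(η) = exp(−η†η)` (4.2)–(4.4): "We work out the dependence of
`⟨w₀⟩_η = ∫D[η] min[ρ(η), ρ(Mη)]` (4.11) on the spectrum `{λᵢ}` of `M†M` … Performing the above
integration in the basis of orthonormal eigenvectors of `M†M` with components `zᵢ` we find
`⟨w₀⟩_η = ∏ᵢ(∫dzᵢdz̄ᵢ/π) min[exp(−Σᵢ|zᵢ|²), exp(−Σᵢλᵢ|zᵢ|²)]` (4.12).  Changing to polar variables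
in all the complex planes we get `⟨w₀⟩_η = ∏ᵢ(∫₀^∞duᵢ) min[exp(−Σᵢuᵢ), exp(−Σᵢλᵢuᵢ)]` (4.13).  In
appendix A this integral is evaluated exactly yielding
`⟨w₀⟩_η = Σᵢ min(1,1/λᵢ) ∏_{j≠i}(λᵢ−1)/(λᵢ−λⱼ)` (4.14)".  The probabilistic reading of "changing to
polar variables" used here: for a standard complex Gaussian `W` (density `f_W(w) = (1/π)e^{−|w|²}`,
Lapidoth, *A Foundation in Digital Communication*, Def. 24.2.1 / eq. (24.1), "real and imaginary
parts … independent `𝒩(0,1/2)`") the squared modulus `|W|²` is mean-one exponential (ibid.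
Note 19.8.1: "The central `χ²` distribution with two degrees of freedom `χ²₂` is the mean-2
exponential distribution", for `2|W|²`).

What is proved:
* `cgauss` — the standard complex Gaussian law `CN(0,1) = (1/π)e^{−|z|²} d Re z d Im z` on `ℂ`
  (= the one-component factor `D[η]ρ(η)` of (4.2)–(4.4)); `cgauss_real_normSq_le` (its radial
  distribution function `P{|W|² ≤ t} = 1 − e^{−t}`, by Mathlib's `integral_fun_norm_addHaar` —
  "changing to polar variables"); **`map_normSq_cgauss : cgauss.map (|·|²) = Exp(1)`**;
  `pi_cgauss_eq_withDensity` (`⊗ᵢ CN(0,1) = D[η]ρ(η)` on `ℂ^ι`) and `map_normSq_pi_cgauss`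
  (`(|zᵢ|²)ᵢ` are i.i.d. `Exp(1)` — (4.12) = (4.13));
* `sum_normSq_mulVec_eq_sum_eigenvalues` : `‖Mη‖² = Σᵢ λᵢ |(U†η)ᵢ|²` with `M†M = U diag(λ) U†`
  (Mathlib's `Matrix.IsHermitian.spectral_theorem`), and `integral_mulVec_radial` : the unitary
  change of variables `η = Uz` (Jacobian `|det U|² = 1`) — (4.11) = (4.12); `integral_exp_neg_mul_radial_eq` :
  `∫_{ℂ^ι} e^{−Σ|zᵢ|²} G((|zᵢ|²)ᵢ) dz = π^{|ι|} ∫ G d(⊗ᵢ Exp(1))` — (4.12) = (4.13);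
* **`integral_min_gaussian_mulVec_eq_sum`** — (4.11) = (4.14): for an invertible complex matrix `M`
  whose `M†M` has pairwise distinct eigenvalues `λᵢ ≠ 1`,
  `∫_{ℂ^ι} min[e^{−‖η‖²}, e^{−‖Mη‖²}] dη = π^{|ι|} · Σᵢ min(1, 1/λᵢ) ∏_{j≠i} (λᵢ − 1)/(λᵢ − λⱼ)`,
  i.e. with the tree's normalisation-free convention of `PseudofermionIntegral.lean`,
  `⟨w₀⟩_η = ∫D[η] min[ρ(η), ρ(Mη)] = Σᵢ min(1, 1/λᵢ) ∏_{j≠i} (λᵢ − 1)/(λᵢ − λⱼ)`.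

Honest scope: as in `StochasticAcceptanceSpectrum.lean` (`λᵢ = 1` and degenerate spectra excluded;
partially stochastic case not treated).

## References
* [KnechtliWolff2003] F. Knechtli, U. Wolff, Nucl. Phys. B 663 (2003) 3, §4.1 eqs. (4.2)–(4.4),
  (4.11)–(4.14).
* [Lapidoth2017] A. Lapidoth, A Foundation in Digital Communication, 2nd ed., CUP 2017, §24.2.1
  Def. 24.2.1 / eq. (24.1); §19.8 Note 19.8.1.
-/

namespace Literature.MathematicalPhysics.QuantumFieldTheory.StochasticAcceptance

open MeasureTheory ProbabilityTheory Set Real Matrix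
open Literature.Probability.Distributions Literature.Analysis.SpecialFunctions
open scoped ENNReal ComplexConjugate ComplexOrder

/-! ## The standard complex Gaussian and the law of its squared modulus -/

section ComplexGaussian

/-- The standard complex Gaussian law `CN(0,1)`: density `(1/π) e^{−|w|²}` with respect to
`d Re w d Im w` — one component of Knechtli–Wolff's `D[η]ρ(η)`.
[cite: Lapidoth2017, Def. 24.2.1 / eq. (24.1)]; [cite: KnechtliWolff2003, §4.1 eqs. (4.2)–(4.4)] -/
noncomputable def cgauss : Measure ℂ :=
  volume.withDensity fun z => ENNReal.ofReal (Real.exp (-‖z‖ ^ 2) / Real.pi)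

/-- The density of `CN(0,1)` is nonnegative. [folklore] -/
private theorem cgauss_density_nonneg (z : ℂ) : 0 ≤ Real.exp (-‖z‖ ^ 2) / Real.pi :=
  div_nonneg (Real.exp_pos _).le Real.pi_pos.le

/-- The density of `CN(0,1)` is measurable. [folklore] -/
private theorem measurable_cgauss_density :
    Measurable fun z : ℂ => ENNReal.ofReal (Real.exp (-‖z‖ ^ 2) / Real.pi) := by
  fun_prop

/-- Integration against `CN(0,1)`. [cite: Lapidoth2017, eq. (24.1)] -/
theorem integral_cgauss (g : ℂ → ℝ) :
    ∫ z, g z ∂cgauss = ∫ z, (Real.exp (-‖z‖ ^ 2) / Real.pi) * g z := by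
  rw [cgauss, integral_withDensity_eq_integral_toReal_smul measurable_cgauss_density
    (ae_of_all _ fun z => by simp)]
  refine integral_congr_ae (ae_of_all _ fun z => ?_)
  show (ENNReal.ofReal (Real.exp (-‖z‖ ^ 2) / Real.pi)).toReal • g z = _
  rw [ENNReal.toReal_ofReal (cgauss_density_nonneg z), smul_eq_mul]

/-- `CN(0,1)` is a probability law (`∫_ℂ e^{−|z|²} = π`). [cite: Lapidoth2017, eq. (24.1)] -/
theorem isProbabilityMeasure_cgauss : IsProbabilityMeasure cgauss := by
  constructor
  rw [cgauss, withDensity_apply _ MeasurableSet.univ, Measure.restrict_univ]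
  have hint : Integrable fun z : ℂ => Real.exp (-‖z‖ ^ 2) / Real.pi :=
    (Integrable.of_integral_ne_zero (by rw [integral_complex_rexp_neg_normSq]; positivity)).div_const _
  rw [← ofReal_integral_eq_lintegral_ofReal hint (ae_of_all _ cgauss_density_nonneg),
    integral_div, integral_complex_rexp_neg_normSq, div_self Real.pi_pos.ne', ENNReal.ofReal_one]

/-- `∫₀^{√t} y e^{−y²} dy = (1 − e^{−t})/2` for `t ≥ 0`. [folklore] -/
private theorem integral_mul_exp_neg_sq {t : ℝ} (ht : 0 ≤ t) :
    ∫ y in Ioc 0 (Real.sqrt t), y * Real.exp (-y ^ 2) = (1 - Real.exp (-t)) / 2 := by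
  rw [← intervalIntegral.integral_of_le (Real.sqrt_nonneg t)]
  have hderiv : ∀ y ∈ Set.uIcc 0 (Real.sqrt t),
      HasDerivAt (fun y => -Real.exp (-y ^ 2) / 2) (y * Real.exp (-y ^ 2)) y := by
    intro y _
    have hsq : HasDerivAt (fun y : ℝ => y ^ 2) (2 * y) y := by
      simpa using hasDerivAt_pow 2 y
    have h1 : HasDerivAt (fun y : ℝ => -y ^ 2) (-(2 * y)) y := hsq.neg
    exact ((h1.exp.neg).div_const 2).congr_deriv (by ring)
  rw [intervalIntegral.integral_eq_sub_of_hasDerivAt hderiv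
    ((Continuous.continuousOn (by fun_prop)).intervalIntegrable)]
  rw [Real.sq_sqrt ht]
  simp
  ring

/-- **The radial distribution function of `CN(0,1)`** ("changing to polar variables"):
`P{|W|² ≤ t} = 1 − e^{−t}` for `t ≥ 0` (and `0` for `t < 0`).
[cite: KnechtliWolff2003, §4.1 (4.12)–(4.13)]; [cite: Lapidoth2017, Note 19.8.1] -/
theorem cgauss_real_normSq_le (t : ℝ) :
    cgauss.real {z : ℂ | ‖z‖ ^ 2 ≤ t} = if 0 ≤ t then 1 - Real.exp (-t) else 0 := by
  have hS : MeasurableSet {z : ℂ | ‖z‖ ^ 2 ≤ t} :=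
    measurableSet_le (by fun_prop) measurable_const
  rw [← integral_indicator_one hS, integral_cgauss]
  -- the integrand is a function of the modulus
  set h : ℝ → ℝ := fun y => if y ^ 2 ≤ t then Real.exp (-y ^ 2) / Real.pi else 0 with hh
  have hrad : (fun z : ℂ => Real.exp (-‖z‖ ^ 2) / Real.pi * ({z : ℂ | ‖z‖ ^ 2 ≤ t}.indicator 1 z))
      = fun z => h ‖z‖ := by
    funext z
    simp only [hh, Set.indicator_apply, mem_setOf_eq, Pi.one_apply]
    split_ifs <;> simp
  rw [hrad, integral_fun_norm_addHaar volume h, Complex.finrank_real_complex]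
  have hball : (volume : Measure ℂ).real (Metric.ball 0 1) = Real.pi := by
    rw [measureReal_def, Complex.volume_ball]
    simp
  rw [hball]
  simp only [Nat.add_one_sub_one, pow_one, smul_eq_mul, nsmul_eq_mul, Nat.cast_ofNat]
  -- reduce the radial integral to `(0, √t]`
  by_cases ht : 0 ≤ t
  · rw [if_pos ht]
    have hEq : EqOn (fun y => y * h y)
        ((Iic (Real.sqrt t)).indicator fun y => y * Real.exp (-y ^ 2) / Real.pi) (Ioi 0) := by
      intro y hy
      have hy' : 0 ≤ y := le_of_lt hy
      simp only [hh, Set.indicator_apply, mem_Iic]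
      by_cases hyt : y ≤ Real.sqrt t
      · have : y ^ 2 ≤ t := (Real.le_sqrt hy' ht).mp hyt
        rw [if_pos this, if_pos hyt]; ring
      · have : ¬ y ^ 2 ≤ t := fun h' => hyt ((Real.le_sqrt hy' ht).mpr h')
        rw [if_neg this, if_neg hyt]; ring
    rw [setIntegral_congr_fun measurableSet_Ioi hEq, setIntegral_indicator measurableSet_Iic,
      Ioi_inter_Iic]
    simp_rw [div_eq_mul_inv (_ * Real.exp _) Real.pi]
    rw [integral_mul_const, integral_mul_exp_neg_sq ht]
    field_simp
  · rw [if_neg ht]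
    have hEq : EqOn (fun y => y * h y) (fun _ => 0) (Ioi 0) := by
      intro y _
      have : ¬ y ^ 2 ≤ t := fun h' => ht (le_trans (sq_nonneg y) h')
      simp only [hh, if_neg this, mul_zero]
    rw [setIntegral_congr_fun measurableSet_Ioi hEq, integral_zero]
    simp

/-- **`|W|²` of a standard complex Gaussian is mean-one exponential**:
`CN(0,1) ∘ (|·|²)⁻¹ = Exp(1)`. [cite: Lapidoth2017, Note 19.8.1 with eq. (24.1)];
[cite: KnechtliWolff2003, §4.1 (4.12)–(4.13)] -/
theorem map_normSq_cgauss : cgauss.map (fun z : ℂ => ‖z‖ ^ 2) = expMeasure 1 := by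
  haveI := isProbabilityMeasure_cgauss
  haveI := isProbabilityMeasure_expMeasure (zero_lt_one' ℝ)
  have hm : Measurable fun z : ℂ => ‖z‖ ^ 2 := by fun_prop
  haveI : IsProbabilityMeasure (cgauss.map fun z : ℂ => ‖z‖ ^ 2) :=
    Measure.isProbabilityMeasure_map hm.aemeasurable
  refine Measure.ext_of_Iic _ _ fun t => ?_
  have h1 : (cgauss.map fun z : ℂ => ‖z‖ ^ 2).real (Iic t) = (expMeasure 1).real (Iic t) := by
    rw [map_measureReal_apply hm measurableSet_Iic, expMeasure_real_Iic one_pos, one_mul]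
    exact cgauss_real_normSq_le t
  rw [← ofReal_measureReal, ← ofReal_measureReal, h1]

variable {ι : Type*} [Fintype ι]

/-- **`D[η]ρ(η) = ⊗ᵢ CN(0,1)`**: Lebesgue measure on `ℂ^ι` with density `∏ᵢ (1/π)e^{−|zᵢ|²}` is the
product of standard complex Gaussians. [cite: KnechtliWolff2003, §4.1 eqs. (4.2)–(4.4), (4.12)] -/
theorem pi_cgauss_eq_withDensity :
    Measure.pi (fun _ : ι => cgauss)
      = (volume : Measure (ι → ℂ)).withDensity
          fun w => ∏ i, ENNReal.ofReal (Real.exp (-‖w i‖ ^ 2) / Real.pi) := by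
  haveI := isProbabilityMeasure_cgauss
  haveI : ∀ _i : ι, SigmaFinite ((volume : Measure ℂ).withDensity
      fun z => ENNReal.ofReal (Real.exp (-‖z‖ ^ 2) / Real.pi)) := fun _ =>
    show SigmaFinite cgauss from inferInstance
  rw [volume_pi]
  exact GaussianToolkit.pi_withDensity (fun _ : ι => (volume : Measure ℂ))
    (fun _ z => ENNReal.ofReal (Real.exp (-‖z‖ ^ 2) / Real.pi)) fun _ => measurable_cgauss_density

/-- **(4.12) = (4.13)**: under `⊗ᵢ CN(0,1)` the squared moduli `(|zᵢ|²)ᵢ` are i.i.d. `Exp(1)`.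
[cite: KnechtliWolff2003, §4.1 (4.12)–(4.13)]; [cite: Lapidoth2017, Note 19.8.1] -/
theorem map_normSq_pi_cgauss :
    (Measure.pi fun _ : ι => cgauss).map (fun w : ι → ℂ => fun i => ‖w i‖ ^ 2)
      = Measure.pi fun _ : ι => expMeasure 1 := by
  haveI := isProbabilityMeasure_cgauss
  rw [Measure.pi_map_pi fun _ => (by fun_prop : Measurable fun z : ℂ => ‖z‖ ^ 2).aemeasurable]
  simp_rw [map_normSq_cgauss]

/-- **Integration of a function of the squared moduli against `D[η]ρ(η)`** ((4.12) → (4.13)):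
`∫_{ℂ^ι} e^{−Σ|zᵢ|²} G((|zᵢ|²)ᵢ) dz = π^{|ι|} ∫ G d(⊗ᵢ Exp(1))`.
[cite: KnechtliWolff2003, §4.1 (4.12)–(4.13)] -/
theorem integral_exp_neg_mul_radial_eq (G : (ι → ℝ) → ℝ) (hG : Measurable G) :
    ∫ w : ι → ℂ, Real.exp (-(∑ i, ‖w i‖ ^ 2)) * G (fun i => ‖w i‖ ^ 2)
      = Real.pi ^ Fintype.card ι * ∫ u, G u ∂(Measure.pi fun _ : ι => expMeasure 1) := by
  haveI := isProbabilityMeasure_cgauss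
  have hm : Measurable fun w : ι → ℂ => fun i => ‖w i‖ ^ 2 := by fun_prop
  -- right side: pull `G` back to `ℂ^ι`
  rw [← map_normSq_pi_cgauss, integral_map hm.aemeasurable hG.aestronglyMeasurable,
    pi_cgauss_eq_withDensity,
    integral_withDensity_eq_integral_toReal_smul (by fun_prop)
      (ae_of_all _ fun w => by simp [ENNReal.prod_lt_top])]
  have hdens : ∀ w : ι → ℂ, (∏ i, ENNReal.ofReal (Real.exp (-‖w i‖ ^ 2) / Real.pi)).toReal
      = (Real.pi ^ Fintype.card ι)⁻¹ * Real.exp (-(∑ i, ‖w i‖ ^ 2)) := by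
    intro w
    rw [ENNReal.toReal_prod]
    simp_rw [ENNReal.toReal_ofReal (cgauss_density_nonneg _), div_eq_mul_inv]
    rw [Finset.prod_mul_distrib, Finset.prod_const, Finset.card_univ, ← Real.exp_sum,
      Finset.sum_neg_distrib, inv_pow, mul_comm]
  simp_rw [hdens, smul_eq_mul, mul_assoc]
  rw [integral_const_mul, ← mul_assoc, mul_inv_cancel₀ (pow_ne_zero _ Real.pi_pos.ne'), one_mul]

end ComplexGaussian

/-! ## (4.11) → (4.12): diagonalising `M†M` inside the Gaussian integral -/

section Spectral

variable {ι : Type} [Fintype ι] [DecidableEq ι]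

/-- For a unitary `U`, `‖Uw‖² = ‖w‖²` (componentwise sums of squared moduli). [folklore] -/
private theorem sum_normSq_unitary_mulVec (U : Matrix.unitaryGroup ι ℂ) (w : ι → ℂ) :
    ∑ i, ‖((U : Matrix ι ι ℂ) *ᵥ w) i‖ ^ 2 = ∑ i, ‖w i‖ ^ 2 := by
  have h := re_star_dotProduct_conjTranspose_mul_self_mulVec (U : Matrix ι ι ℂ) w
  rw [← Matrix.star_eq_conjTranspose, Unitary.coe_star_mul_self] at h
  rw [← h, Matrix.one_mulVec]
  simp only [dotProduct, Pi.star_apply, Complex.star_def, Complex.conj_mul', Complex.re_sum]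
  refine Finset.sum_congr rfl fun i _ => ?_
  norm_cast

/-- **`‖Mη‖² = Σᵢ λᵢ |(U†η)ᵢ|²`** where `M†M = U diag(λ) U†` is the unitary diagonalisation of the
Hermitian matrix `M†M` ("the basis of orthonormal eigenvectors of `M†M` with components `zᵢ`").
[cite: KnechtliWolff2003, §4.1 (4.11)–(4.12)] -/
theorem sum_normSq_mulVec_eq_sum_eigenvalues (M : Matrix ι ι ℂ) (η : ι → ℂ) :
    ∑ i, ‖(M *ᵥ η) i‖ ^ 2
      = ∑ i, (Matrix.isHermitian_conjTranspose_mul_self M).eigenvalues i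
          * ‖((star ((Matrix.isHermitian_conjTranspose_mul_self M).eigenvectorUnitary
              : Matrix ι ι ℂ)) *ᵥ η) i‖ ^ 2 := by
  set hA := Matrix.isHermitian_conjTranspose_mul_self M with hhA
  set U : Matrix ι ι ℂ := (hA.eigenvectorUnitary : Matrix ι ι ℂ) with hU
  have hspec : Mᴴ * M = U * Matrix.diagonal (RCLike.ofReal ∘ hA.eigenvalues) * star U := by
    have := hA.spectral_theorem
    rwa [Unitary.conjStarAlgAut_apply] at this
  rw [← re_star_dotProduct_conjTranspose_mul_self_mulVec M η]
  conv_lhs => rw [hspec, ← Matrix.mulVec_mulVec, ← Matrix.mulVec_mulVec, Matrix.dotProduct_mulVec]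
  -- now `re (star w ⬝ᵥ diag(λ) w)` with `w = U† η`
  rw [show star η ᵥ* U = star (star U *ᵥ η) by
    rw [Matrix.star_mulVec, Matrix.star_eq_conjTranspose, Matrix.conjTranspose_conjTranspose]]
  set w := star U *ᵥ η with hw
  simp only [dotProduct, mulVec_diagonal, Pi.star_apply, Complex.star_def, Function.comp_apply,
    Complex.re_sum]
  refine Finset.sum_congr rfl fun i _ => ?_
  have hcoe : (RCLike.ofReal (hA.eigenvalues i) : ℂ) = ((hA.eigenvalues i : ℝ) : ℂ) := rfl
  rw [hcoe, ← mul_assoc, mul_comm (conj (w i)), mul_assoc, Complex.re_ofReal_mul, Complex.conj_mul']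
  norm_cast

/-- The eigenvalues of `M†M` are positive for invertible `M`. [folklore] -/
private theorem eigenvalues_conjTranspose_mul_self_pos (M : Matrix ι ι ℂ) (hM : M.det ≠ 0) (i : ι) :
    0 < (Matrix.isHermitian_conjTranspose_mul_self M).eigenvalues i := by
  have hinj : Function.Injective M.mulVec := by
    intro v w h
    have h0 : M *ᵥ (v - w) = 0 := by rw [Matrix.mulVec_sub, h, sub_self]
    exact sub_eq_zero.mp (Matrix.eq_zero_of_mulVec_eq_zero hM h0)
  exact (Matrix.PosDef.conjTranspose_mul_self M hinj).eigenvalues_pos i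

/-- For a unitary `U`, `|det U|² = 1`. [folklore] -/
private theorem normSq_det_unitary (U : Matrix.unitaryGroup ι ℂ) :
    Complex.normSq (U : Matrix ι ι ℂ).det = 1 := by
  have h : star (U : Matrix ι ι ℂ) * (U : Matrix ι ι ℂ) = 1 := Unitary.coe_star_mul_self U
  have hdet := congrArg Matrix.det h
  rw [Matrix.det_mul, Matrix.star_eq_conjTranspose, Matrix.det_conjTranspose, Matrix.det_one,
    Complex.star_def, ← Complex.normSq_eq_conj_mul_self] at hdet
  exact_mod_cast hdet

/-- **(4.11) = (4.12): the unitary change of variables `η = Uz`** in the Gaussian integral — any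
function of `(‖η‖², ‖Mη‖²)` integrates like the same function of `(Σᵢ|zᵢ|², Σᵢ λᵢ|zᵢ|²)`, `λ` the
spectrum of `M†M`. [cite: KnechtliWolff2003, §4.1 (4.11)–(4.12)] -/
theorem integral_mulVec_radial (M : Matrix ι ι ℂ) (F : ℝ → ℝ → ℝ) :
    ∫ η : ι → ℂ, F (∑ i, ‖η i‖ ^ 2) (∑ i, ‖(M *ᵥ η) i‖ ^ 2)
      = ∫ z : ι → ℂ, F (∑ i, ‖z i‖ ^ 2)
          (∑ i, (Matrix.isHermitian_conjTranspose_mul_self M).eigenvalues i * ‖z i‖ ^ 2) := by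
  set hA := Matrix.isHermitian_conjTranspose_mul_self M with hhA
  set U : Matrix ι ι ℂ := (hA.eigenvectorUnitary : Matrix ι ι ℂ) with hU
  have hUdet : U.det ≠ 0 := by
    intro h
    have := normSq_det_unitary hA.eigenvectorUnitary
    rw [← hU, h, map_zero] at this
    exact zero_ne_one this
  have hcov := integral_comp_mulVec U hUdet
    (fun η => F (∑ i, ‖η i‖ ^ 2) (∑ i, ‖(M *ᵥ η) i‖ ^ 2))
  rw [normSq_det_unitary, inv_one, one_mul] at hcov
  rw [← hcov]
  refine integral_congr_ae (ae_of_all _ fun z => ?_)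
  simp only
  rw [sum_normSq_unitary_mulVec, sum_normSq_mulVec_eq_sum_eigenvalues M, ← hU, Matrix.mulVec_mulVec,
    Unitary.coe_star_mul_self, Matrix.one_mulVec]

/-- **KNECHTLI–WOLFF (4.11) = (4.14): the mean one-pseudofermion stochastic acceptance as a
function of the spectrum of `M†M`.**  For an invertible complex matrix `M` (the ratio operator
`(D'_W + m)⁻¹(D_W + m)`) whose `M†M` has pairwise distinct eigenvalues `λᵢ ≠ 1`,
`∫_{ℂ^ι} min[e^{−‖η‖²}, e^{−‖Mη‖²}] dη = π^{|ι|} Σᵢ min(1, 1/λᵢ) ∏_{j≠i} (λᵢ − 1)/(λᵢ − λⱼ)`, i.e.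
`⟨w₀⟩_η = ∫D[η] min[ρ(η), ρ(Mη)] = Σᵢ min(1, 1/λᵢ) ∏_{j≠i} (λᵢ − 1)/(λᵢ − λⱼ)` with
`D[η] = ∏ d Re η d Im η/π`.
[cite: KnechtliWolff2003, §4.1 eqs. (4.11)–(4.14), App. A (A.16)–(A.18)] -/
theorem integral_min_gaussian_mulVec_eq_sum [Nonempty ι] (M : Matrix ι ι ℂ) (hM : M.det ≠ 0)
    (hinj : Function.Injective (Matrix.isHermitian_conjTranspose_mul_self M).eigenvalues)
    (hne : ∀ i, (Matrix.isHermitian_conjTranspose_mul_self M).eigenvalues i ≠ 1) :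
    ∫ η : ι → ℂ, min (Real.exp (-(∑ i, ‖η i‖ ^ 2))) (Real.exp (-(∑ i, ‖(M *ᵥ η) i‖ ^ 2)))
      = Real.pi ^ Fintype.card ι *
          ∑ i, min 1 ((Matrix.isHermitian_conjTranspose_mul_self M).eigenvalues i)⁻¹ *
            kwWeight (Matrix.isHermitian_conjTranspose_mul_self M).eigenvalues i := by
  have hpos : ∀ i, 0 < (Matrix.isHermitian_conjTranspose_mul_self M).eigenvalues i :=
    eigenvalues_conjTranspose_mul_self_pos M hM
  -- (4.11) → (4.12): diagonalise
  rw [integral_mulVec_radial M (fun a b => min (Real.exp (-a)) (Real.exp (-b)))]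
  -- factor `e^{−Σ|zᵢ|²}` out of the `min`
  have hGm : Measurable (fun u : ι → ℝ => min 1 (Real.exp (-(∑ i,
      ((Matrix.isHermitian_conjTranspose_mul_self M).eigenvalues i - 1) * u i)))) := by
    fun_prop
  have hfac : ∀ z : ι → ℂ, min (Real.exp (-(∑ i, ‖z i‖ ^ 2)))
      (Real.exp (-(∑ i, (Matrix.isHermitian_conjTranspose_mul_self M).eigenvalues i * ‖z i‖ ^ 2)))
      = Real.exp (-(∑ i, ‖z i‖ ^ 2)) * min 1 (Real.exp (-(∑ i,
          ((Matrix.isHermitian_conjTranspose_mul_self M).eigenvalues i - 1) * ‖z i‖ ^ 2))) := by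
    intro z
    rw [mul_min_of_nonneg _ _ (Real.exp_pos _).le, mul_one, ← Real.exp_add]
    congr 2
    rw [← Finset.sum_neg_distrib, ← Finset.sum_neg_distrib, ← Finset.sum_neg_distrib,
      ← Finset.sum_add_distrib]
    exact Finset.sum_congr rfl fun i _ => by ring
  simp_rw [hfac]
  -- (4.12) → (4.13) → (4.14)
  have key := integral_exp_neg_mul_radial_eq (fun u : ι → ℝ => min 1 (Real.exp (-(∑ i,
      ((Matrix.isHermitian_conjTranspose_mul_self M).eigenvalues i - 1) * u i)))) hGm
  beta_reduce at key
  rw [key, integral_pi_min_one_exp_neg_sum hpos hne hinj]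

end Spectral

end Literature.MathematicalPhysics.QuantumFieldTheory.StochasticAcceptance
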